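import Mathlib
import Literature.MathematicalPhysics.QuantumLattice.WilsonLoops
import Literature.Probability.LatticeModels.GibbsSpecification
import HarnessLib

/-!
# First-order transitions in Potts lattice gauge theories with a large finite gauge group:
# Kotecký–Shlosman (1982) Theorem 3 and Kotecký–Laanait–Messager–Ruiz (1990) Theorems 1.4–1.5
# (named facts, infinite lattice `ℤ^d`)

Eleventh file of the transcription of the graphical / FK-type side of Potts lattice gauge theory
(census REDUCTION-CENSUS §I: "first-order transitions in Potts gauge models — where complete
analyticity genuinely fails"). Companion files on the finite torus: `PlaquetteRandomCluster` and its
sequels (plaquette random-cluster representation, all PROVED). SCOPE caveat, as there: the gauge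
group is FINITE (`ℤ_q`, or any group of `q` elements, `q` large); nothing here bears on the
Yang–Mills mass gap for compact Lie groups or on `BalabanLadder.IR`; in the `ym` ladder only the
conditional finite-`𝕋⁴` rung `BalabanLadder.UV` is closed by any route. The results below are
Pirogov–Sinai / chessboard-estimate theorems whose proofs are not in the tree; they are vendored
as NAMED FACTS (`def … : Prop`), stated in the tree's infinite-lattice gauge vocabulary
(`Literature.MathematicalPhysics.QuantumLattice`: `LGConfig d G`, `ZdEdge`, `ZdPlaquette`,
`plaquetteHolonomyZd`, `plaquettesTouching`, `IsZdTranslationInvariant`, `wilsonLoopObs`,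
`rectWalk`; `Literature.Probability.LatticeModels`: `Specification`, `gibbsMeasures`, `glueWith`).

## Sources (both HELD; loci read on the materialised pages)

* R. Kotecký, S. B. Shlosman, *First-order phase transitions in large entropy lattice models*,
  Comm. Math. Phys. **83** (1982) 493–515 [KoteckyShlosman1982] (`lit read
  paper:galaxy-pdf-2165367554251298200`, PDF pp. 4–5 = pp. 496–497): §2, the gauge Potts model
  with ANY finite gauge group `G` of `q` elements (configurations `σ` on oriented bonds with
  `σ(i,j) = σ(j,i)⁻¹`, plaquette variable `σ_□`, "nonfrustrated" `σ_□ = e`, indicator `P^=_□`,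
  `P^≠_□ = 1 - P^=_□`, Hamiltonian (2.2) `H(σ) = -Σ_□ P^=_□(σ)`), **Theorem 3** (p. 497):
  "A ν-dimensional Potts gauge model with a q-element gauge group G undergoes a first-order phase
  transition in temperature whenever ν ≥ 3 and q is large enough. Namely, for each ν ≥ 3 there is
  q̄(ν) < ∞ such that whenever q ≥ q̄(ν) there is an inverse temperature β_c = β_c(q, ν) for which
  there are translation invariant Gibbs states ⟨ ⟩^=_{β_c} and ⟨ ⟩^≠_{β_c} corresponding to the
  Hamiltonian (2.2) such that ⟨P^=_□⟩^=_{β_c} > ½ and ⟨P^≠_□⟩^≠_{β_c} > ½ for each plaquette □."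
  (Proof §5 by reflection positivity / chessboard estimates via the Dobrushin–Shlosman criterion
  Thm. 4; "the bounds q̄(ν) … are ridiculously large".)
* R. Kotecký, L. Laanait, A. Messager, J. Ruiz, *The q-state Potts model in the standard
  Pirogov–Sinai theory: surface tensions and Wilson loops*, J. Stat. Phys. **58** (1990) 199–248
  [KoteckyLaanaitMessagerRuiz1990] (`lit read paper:galaxy-pdf-166530208885860340`, PDF pp. 5–8):
  §1.3, the `ℤ_q` gauge Potts model on the links `L` of `ℤ^d` (`σ_l ∈ ℤ_q`,
  `σ_{⟨x,y⟩} + σ_{⟨y,x⟩} = 0`, `σ(p)` = oriented sum around the plaquette, for a finite link set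
  `Λ`: `H^{bc}_Λ(σ_Λ) = -Σ_{p ⊂ Λ} δ_{σ(p),0} - Σ_{p ∩ Λ ≠ ∅, p ∩ Λᶜ ≠ ∅} δ_{σ(p),0}`, closed (`0`)
  b.c. = outside links set to `0`, free b.c. = second sum omitted; Gibbs measures
  `Z⁻¹ e^{-βH}` (1.2.2); `⟨·⟩^{bc}(β)` "denotes the corresponding infinite-volume limit"; free
  energy `f(βH) = lim_{Λ↑ℤ^d} |Λ|⁻¹ log Z^{bc}_Λ(β)`, van Hove limit), **Theorem 1.4** ("If d = 3
  and q is large enough, there exists a first-order transition point β'_t(q) where the derivative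
  of the free energy with respect to β is discontinuous: (a) ⟨δ_{σ(p),0}⟩^0(β'_t) > ½,
  (b) ⟨δ_{σ(p),0}⟩^f(β'_t) < ½"), the Wilson parameter `(1/(q-1))⟨q δ_{σ(𝓛),0} - 1⟩` of a loop
  `𝓛` of size `L·T` (`σ(𝓛) = Σ_{l ∈ 𝓛} σ_l mod q`), **Theorem 1.5** ("If d = 3 and q is large
  enough, there exist constants k and k' > 0 such that one has: (a)
  (1/(q-1))⟨qδ_{σ(𝓛),0} - 1⟩^f(β) ≤ e^{-kLT} if β ≤ β'_t; (b) … ≥ e^{-k'(L+T)} if β > β'_t (free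
  b.c.); (c) (1/(q-1))⟨qδ_{σ(𝓛),0} - 1⟩^0(β) ≥ e^{-k'(L+T)} if β ≥ β'_t" — "the Wilson parameter
  exhibits a direct transition from a regime of area law decay to a regime of perimeter law decay.
  Moreover, the Wilson string tension is discontinuous at β'_t"). Proofs: duality to a standard
  Pirogov–Sinai contour model (§2, App. A) and cluster expansion (§3.4).
* The `d = 4` analogue (self-dual `ℤ_q` gauge Potts, discontinuous string tension at `β_t`):
  L. Laanait, A. Messager, J. Ruiz, Comm. Math. Phys. **126** (1989) 103–131
  [LaanaitMessagerRuiz1989] — NOT HELD (acquisition request acq-13631); not typed here.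

## Readings (transcriber's; each makes the fact WEAKER than or equivalent to the print)

* (R1) "Gibbs state corresponding to the Hamiltonian (2.2) at inverse temperature β" = DLR
  measure (`gibbsMeasures`) of the specification `pottsGaugeSpec β`, whose kernel in the finite
  link set `Λ` with boundary condition `η` is the uniform (= Haar) product measure on the links of
  `Λ`, glued with `η` off `Λ`, tilted by `β · #{p : p ∩ Λ ≠ ∅, σ_p = e}` (`= e^{-βH^{bc}_Λ}` up to
  normalisation, exactly the kernel with boundary terms of [KoteckyLaanaitMessagerRuiz1990] §1.3);
  translation invariance is `IsZdTranslationInvariant`.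
* (R2) The gauge group of [KoteckyShlosman1982] Thm. 3 is any finite group with `q` elements;
  that of [KoteckyLaanaitMessagerRuiz1990] is `ℤ_q`, typed as "any finite CYCLIC group of order
  `q`" (`IsCyclic G`, `Fintype.card G = q`; the model depends on `G` only up to isomorphism), so
  that no instance needs to be declared on `ZMod q`. A measurable structure with measurable
  singletons is assumed on `G` (every subset of the finite group is then measurable).
* (R3) Infinite-volume states `⟨·⟩^f(β)`, `⟨·⟩^0(β)` of KLMR are limits of the finite-volume free /
  closed-b.c. measures along `Λ ↑ ℤ³`. We state every printed inequality about them in the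
  junk-free SEQUENTIAL form along the link sets `linkBox n` of the cubes `[-n,n]³` (a van Hove
  sequence): "`⟨A⟩(β) > ½`" becomes "`∃ δ > 0`, eventually `⟨A⟩_{Λ_n}(β) ≥ ½ + δ`", "`⟨A⟩(β) ≤ c`"
  becomes "`∀ ε > 0`, eventually `⟨A⟩_{Λ_n}(β) ≤ c + ε`" — each implied by the printed statement
  about the limit (which the source asserts to exist).
* (R4) "Loop `𝓛` of size `L·T`": the `L × T` rectangle in the `(0,1)` coordinate plane based at
  the origin (`rectWalk 0 0 1 L T`, the tree's convention for `rectExpectation`), `L, T ≥ 1`; the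
  Wilson parameter is the loop observable of the class function `wilsonParamFn`,
  `g ↦ (q·1_{g = e} - 1)/(q - 1)`.
* (R5) "constants k and k' > 0" is read as `k > 0` and `k' > 0`; the inverse temperatures in
  Thm. 1.5 (a) are taken `> 0`. "The derivative of the free energy is discontinuous at β'_t" is
  typed as: the free energy density `f(β) = lim_n |Λ_n|⁻¹ log Z^f_{Λ_n}(β)` exists for every `β`
  (`Z^f_Λ(β) = Σ_{σ_Λ} e^{β #{p ⊂ Λ : σ(p) = 0}}` as printed, `|Λ|` = number of links) and `f` is
  not differentiable at `β'_t` (`f` is convex, so this is exactly a jump of `f'`).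
* (R6) "for each plaquette" is explicit in KS82 Thm. 3 and implicit (translation invariance of
  the limit states) in KLMR Thm. 1.4; both facts quantify over all plaquettes.

## Contents

* definitions (with bodies): `IsFlat`, `plaquettesInside`, `flatCountTouching`, `flatCountInside`,
  `uniformMeasure`, `pottsGaugeSpec` (the Potts-gauge specification), `freeMeasure`,
  `closedMeasure`, `siteBox`, `linkBox`, `freePartitionFn`, `wilsonParamFn`;
* named facts: `KoteckyShlosman1982_thm3`, `KLMR1990_thm14_thm15` (Theorems 1.4 and 1.5 share
  the transition point `β'_t`, so they are one statement), with the proved projections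
  `KLMR1990_thm14_thm15.coexistence`, `KLMR1990_thm14_thm15.areaLaw`.
-/

noncomputable section

open MeasureTheory Filter Topology Finset
open scoped ENNReal
open Literature.Probability.LatticeModels Literature.MathematicalPhysics.QuantumLattice

namespace Literature.MathematicalPhysics.QuantumFieldTheory

namespace PottsGaugeZd

variable {d : ℕ} {G : Type*} [Group G]

/-! ### The Potts gauge interaction on `ℤ^d` -/

/-- The plaquette `p` is NON-FRUSTRATED ("`σ_□ = e`", KS82; "`σ(p) = 0`", KLMR) in the
configuration `U`: its holonomy is the identity (independent of orientation and base point).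
[cite: KoteckyShlosman1982, §2 (P^=_□, eq. (2.2))] -/
def IsFlat (U : LGConfig d G) (p : ZdPlaquette d) : Prop :=
  plaquetteHolonomyZd U p.1 p.2.1.1 p.2.1.2 = 1

/-- The plaquettes all four of whose links lie in the finite link set `Λ` (the "`p ⊂ Λ`" of the
free-boundary Hamiltonian). [cite: KoteckyLaanaitMessagerRuiz1990, §1.3 (H^{bc}_Λ, first sum)] -/
def plaquettesInside (Λ : Finset (ZdEdge d)) : Finset (ZdPlaquette d) :=
  (plaquettesTouching Λ).filter fun p => plaquetteEdges p ⊆ Λ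

open Classical in
/-- `#{p : p ∩ Λ ≠ ∅, σ(p) = 0}`: the number of non-frustrated plaquettes among those having at
least one link in `Λ`; `-β` times this is `β H^{0/η}_Λ` (both sums of the printed Hamiltonian,
the outside links being read from the configuration). [cite: KoteckyLaanaitMessagerRuiz1990, §1.3 (H^{bc}_Λ)] -/
def flatCountTouching (Λ : Finset (ZdEdge d)) (U : LGConfig d G) : ℕ :=
  ((plaquettesTouching Λ).filter fun p => IsFlat U p).card

open Classical in
/-- `#{p ⊂ Λ : σ(p) = 0}`: the number of non-frustrated plaquettes inside `Λ` (free boundary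
conditions: "the second sum is omitted"). [cite: KoteckyLaanaitMessagerRuiz1990, §1.3 (free b.c.)] -/
def flatCountInside (Λ : Finset (ZdEdge d)) (U : LGConfig d G) : ℕ :=
  ((plaquettesInside Λ).filter fun p => IsFlat U p).card

section Measures

variable (G) in
/-- The normalised counting measure on the finite gauge group (its Haar probability measure; the
a-priori single-link measure of the Gibbs measures (1.2.2)). [cite: KoteckyLaanaitMessagerRuiz1990, §1.2 eq. (1.2.2)] -/
def uniformMeasure [Fintype G] [MeasurableSpace G] : Measure G :=
  ((Fintype.card G : ℝ≥0∞)⁻¹) • Measure.count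

variable [Fintype G] [MeasurableSpace G]

/-- **The Potts-gauge specification at inverse temperature `β`** (reading R1): in the finite link
set `Λ` with boundary condition `η`, the uniform product measure on the links of `Λ` glued with
`η` off `Λ` (`glueWith`), tilted by `β · #{p : p ∩ Λ ≠ ∅, σ_p = e}` — i.e. the finite-volume Gibbs
measure `Z⁻¹ e^{-βH^{η}_Λ}` with the printed Hamiltonian including boundary plaquettes. Same
construction as the tree's Wilson specification `ymSpecification`, with the Potts action in place
of the Wilson action. [cite: KoteckyShlosman1982, §2 eq. (2.2) ("Gibbs states … corresponding to the Hamiltonian (2.2)"); KoteckyLaanaitMessagerRuiz1990, §1.3] -/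
def pottsGaugeSpec (β : ℝ) : Specification (ZdEdge d) G :=
  fun Λ η => ((Measure.pi fun _ : ↥Λ => uniformMeasure G).map (glueWith Λ · η)).tilted
    fun U => β * (flatCountTouching Λ U : ℝ)

/-- The finite-volume Potts gauge measure in the link set `Λ` with FREE boundary conditions
(Hamiltonian `-Σ_{p ⊂ Λ} δ_{σ(p),0}`), realised on `LGConfig d G` with the links off `Λ` set to
the identity (they do not enter the Hamiltonian). [cite: KoteckyLaanaitMessagerRuiz1990, §1.3 (free b.c.) and eq. (1.2.2)] -/
def freeMeasure (β : ℝ) (Λ : Finset (ZdEdge d)) : Measure (LGConfig d G) :=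
  ((Measure.pi fun _ : ↥Λ => uniformMeasure G).map (glueWith Λ · (fun _ => (1 : G)))).tilted
    fun U => β * (flatCountInside Λ U : ℝ)

/-- The finite-volume Potts gauge measure in `Λ` with CLOSED (`0`) boundary conditions: the
kernel of `pottsGaugeSpec` with all outside links equal to the identity ("`σ_l = 0` for
`l ∈ Λᶜ`"). [cite: KoteckyLaanaitMessagerRuiz1990, §1.3 (closed (0) b.c.)] -/
def closedMeasure (β : ℝ) (Λ : Finset (ZdEdge d)) : Measure (LGConfig d G) :=
  pottsGaugeSpec β Λ fun _ => (1 : G)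

end Measures

section Boxes

/-- The cube of sites `[-n, n]^d`. [cite: KoteckyLaanaitMessagerRuiz1990, §1.2 (Λ ↑ ℤ^d in the van Hove sense)] -/
def siteBox (n : ℕ) : Finset (Fin d → ℤ) :=
  Fintype.piFinset fun _ => Finset.Icc (-(n : ℤ)) n

/-- The link set `Λ_n` of the cube `[-n, n]^d`: positively oriented links with both endpoints in
the cube (reading R3: the van Hove sequence along which the infinite-volume limits are taken).
[cite: KoteckyLaanaitMessagerRuiz1990, §1.3 ("let now Λ be a finite subset of L")] -/
def linkBox (n : ℕ) : Finset (ZdEdge d) :=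
  ((siteBox (d := d) n) ×ˢ (Finset.univ : Finset (Fin d))).filter
    fun e => e.1 + Pi.single e.2 1 ∈ siteBox (d := d) n

end Boxes

section Observables

variable [Fintype G]

/-- The free-boundary partition function as printed, `Z^f_Λ(β) = Σ_{σ_Λ} e^{-βH^f_Λ(σ_Λ)} =
Σ_{σ_Λ ∈ G^Λ} e^{β #{p ⊂ Λ : σ(p) = 0}}`. [cite: KoteckyLaanaitMessagerRuiz1990, §1.2 eq. (1.2.2) and f(βH)] -/
def freePartitionFn (β : ℝ) (Λ : Finset (ZdEdge d)) : ℝ :=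
  ∑ ζ : (↥Λ → G), Real.exp (β * (flatCountInside Λ (glueWith Λ ζ fun _ => (1 : G)) : ℝ))

variable (G) in
open Classical in
/-- The Wilson-parameter class function of `q`-state gauge Potts theory,
`g ↦ (q · 1_{g = e} - 1)/(q - 1)` (`q = |G|`): its loop observable `wilsonLoopObs` on the loop `𝓛`
is `(1/(q-1)) (q δ_{σ(𝓛),0} - 1)` (reading R4). [cite: KoteckyLaanaitMessagerRuiz1990, §1.3 (Wilson parameter)] -/
def wilsonParamFn : G → ℝ := fun g =>
  ((Fintype.card G : ℝ) * (if g = 1 then 1 else 0) - 1) / ((Fintype.card G : ℝ) - 1)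

end Observables

end PottsGaugeZd

/-! ### Kotecký–Shlosman 1982, Theorem 3 — named fact -/

open PottsGaugeZd in
/-- **Kotecký–Shlosman (1982), Theorem 3 — NAMED FACT (first-order transition of the Potts gauge
model with a large finite gauge group).** For every dimension `ν ≥ 3` there is `q̄(ν) < ∞` such
that for every finite gauge group `G` with `q = |G| ≥ q̄(ν)` elements there is an inverse
temperature `β_c = β_c(q, ν)` at which the Potts gauge model (Hamiltonian (2.2):
`H = -Σ_□ 1_{σ_□ = e}`) has two translation-invariant Gibbs states `μ^=`, `μ^≠` (DLR measures of
`pottsGaugeSpec β_c`, reading R1) with `μ^=(σ_□ = e) > ½` and `μ^≠(σ_□ ≠ e) > ½` for every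
plaquette `□`. (Source: any finite, not necessarily abelian, `G`; proof by chessboard estimates,
§5; `q̄(ν)` "ridiculously large". The sign of `β_c` is not asserted in print and not asserted
here.) [cite: KoteckyShlosman1982, Thm. 3 (p. 497)] -/
def KoteckyShlosman1982_thm3 : Prop :=
  ∀ ν : ℕ, 3 ≤ ν → ∃ qbar : ℕ,
    ∀ (G : Type) [Group G] [Fintype G] [MeasurableSpace G] [MeasurableSingletonClass G],
      qbar ≤ Fintype.card G →
      ∃ βc : ℝ, ∃ μeq μne : Measure (LGConfig ν G),
        μeq ∈ gibbsMeasures (pottsGaugeSpec (d := ν) (G := G) βc) ∧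
        μne ∈ gibbsMeasures (pottsGaugeSpec (d := ν) (G := G) βc) ∧
        IsZdTranslationInvariant μeq ∧ IsZdTranslationInvariant μne ∧
        ∀ p : ZdPlaquette ν,
          (1 / 2 : ℝ) < (μeq {U | IsFlat U p}).toReal ∧
          (1 / 2 : ℝ) < (μne {U | ¬ IsFlat U p}).toReal

/-! ### Kotecký–Laanait–Messager–Ruiz 1990, Theorems 1.4 and 1.5 — named fact -/

open PottsGaugeZd in
/-- **Kotecký–Laanait–Messager–Ruiz (1990), Theorems 1.4 and 1.5 — NAMED FACT (first-order
deconfinement transition of three-dimensional `ℤ_q` gauge Potts theory, `q` large).** There is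
`q₀` such that for every finite cyclic gauge group `G ≅ ℤ_q` with `q ≥ q₀`, in dimension `d = 3`,
there is a transition point `β'_t = β'_t(q)` and constants `k, k' > 0` such that (readings
R1–R6; all infinite-volume statements in sequential form along the link sets `Λ_n` of the cubes
`[-n,n]³`):
* (Thm 1.4) the free energy density `f(β) = lim_n |Λ_n|⁻¹ log Z^f_{Λ_n}(β)` exists for every `β`
  and is not differentiable at `β'_t` ("the derivative of the free energy with respect to β is
  discontinuous"); (a) under CLOSED b.c. at `β'_t` the plaquette order parameter is eventually
  `≥ ½ + δ` (`⟨δ_{σ(p),0}⟩^0(β'_t) > ½`); (b) under FREE b.c. it is eventually `≤ ½ - δ`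
  (`⟨δ_{σ(p),0}⟩^f(β'_t) < ½`);
* (Thm 1.5) for the Wilson parameter `W = (1/(q-1))⟨q δ_{σ(𝓛),0} - 1⟩` of the `L × T` rectangle:
  (a) AREA LAW up to and at the transition under free b.c.: `W^f_{Λ_n}(β) ≤ e^{-kLT} + ε`
  eventually, for `0 < β ≤ β'_t`; (b) PERIMETER LAW above it under free b.c.:
  `W^f_{Λ_n}(β) ≥ e^{-k'(L+T)} - ε` eventually, for `β > β'_t`; (c) the same under closed b.c.
  for `β ≥ β'_t` — "a direct transition from a regime of area law decay to a regime of perimeter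
  law decay … the Wilson string tension is discontinuous at β'_t".
[cite: KoteckyLaanaitMessagerRuiz1990, Thm. 1.4 and Thm. 1.5 (§1.3)] -/
def KLMR1990_thm14_thm15 : Prop :=
  ∃ q₀ : ℕ, ∀ (G : Type) [Group G] [Fintype G] [MeasurableSpace G] [MeasurableSingletonClass G],
    IsCyclic G → q₀ ≤ Fintype.card G →
    ∃ βt k k' : ℝ, 0 < k ∧ 0 < k' ∧
      -- Theorem 1.4, first clause: the free energy exists and its derivative jumps at `β'_t`
      (∃ f : ℝ → ℝ,
        (∀ β : ℝ, Tendsto (fun n : ℕ =>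
            Real.log (freePartitionFn (d := 3) (G := G) β (linkBox n)) /
              ((linkBox (d := 3) n).card : ℝ)) atTop (𝓝 (f β))) ∧
        ¬ DifferentiableAt ℝ f βt) ∧
      -- Theorem 1.4 (a): closed b.c., `⟨δ_{σ(p),0}⟩^0(β'_t) > 1/2`
      (∀ p : ZdPlaquette 3, ∃ δ : ℝ, 0 < δ ∧ ∀ᶠ n : ℕ in atTop,
        1 / 2 + δ ≤ ((closedMeasure (G := G) βt (linkBox (d := 3) n)) {U | IsFlat U p}).toReal) ∧
      -- Theorem 1.4 (b): free b.c., `⟨δ_{σ(p),0}⟩^f(β'_t) < 1/2`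
      (∀ p : ZdPlaquette 3, ∃ δ : ℝ, 0 < δ ∧ ∀ᶠ n : ℕ in atTop,
        ((freeMeasure (G := G) βt (linkBox (d := 3) n)) {U | IsFlat U p}).toReal ≤ 1 / 2 - δ) ∧
      -- Theorem 1.5 (a): area law under free b.c. for `0 < β ≤ β'_t`
      (∀ β : ℝ, 0 < β → β ≤ βt → ∀ L T : ℕ, 1 ≤ L → 1 ≤ T → ∀ ε : ℝ, 0 < ε →
        ∀ᶠ n : ℕ in atTop,
          ∫ U, wilsonLoopObs (wilsonParamFn G) (rectWalk (0 : Fin 3 → ℤ) 0 1 L T) U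
              ∂(freeMeasure (G := G) β (linkBox (d := 3) n)) ≤
            Real.exp (-k * L * T) + ε) ∧
      -- Theorem 1.5 (b): perimeter law under free b.c. for `β > β'_t`
      (∀ β : ℝ, βt < β → ∀ L T : ℕ, 1 ≤ L → 1 ≤ T → ∀ ε : ℝ, 0 < ε →
        ∀ᶠ n : ℕ in atTop,
          Real.exp (-k' * (L + T)) - ε ≤
            ∫ U, wilsonLoopObs (wilsonParamFn G) (rectWalk (0 : Fin 3 → ℤ) 0 1 L T) U
              ∂(freeMeasure (G := G) β (linkBox (d := 3) n))) ∧
      -- Theorem 1.5 (c): perimeter law under closed b.c. for `β ≥ β'_t`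
      (∀ β : ℝ, βt ≤ β → ∀ L T : ℕ, 1 ≤ L → 1 ≤ T → ∀ ε : ℝ, 0 < ε →
        ∀ᶠ n : ℕ in atTop,
          Real.exp (-k' * (L + T)) - ε ≤
            ∫ U, wilsonLoopObs (wilsonParamFn G) (rectWalk (0 : Fin 3 → ℤ) 0 1 L T) U
              ∂(closedMeasure (G := G) β (linkBox (d := 3) n)))

/-- **Phase coexistence at `β'_t` (Thm 1.4 (a)+(b)), extracted from the fact:** at the transition
point the closed-b.c. and free-b.c. plaquette order parameters are eventually separated by the
value `½` — so the two boundary conditions have different infinite-volume limits (the calibration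
point where complete analyticity / Dobrushin–Shlosman mixing fails for these models).
[cite: KoteckyLaanaitMessagerRuiz1990, Thm. 1.4] -/
theorem KLMR1990_thm14_thm15.coexistence (h : KLMR1990_thm14_thm15) :
    ∃ q₀ : ℕ, ∀ (G : Type) [Group G] [Fintype G] [MeasurableSpace G] [MeasurableSingletonClass G],
      IsCyclic G → q₀ ≤ Fintype.card G → ∃ βt : ℝ, ∀ p : ZdPlaquette 3, ∃ δ : ℝ, 0 < δ ∧
        ∀ᶠ n : ℕ in atTop,
          ((PottsGaugeZd.freeMeasure (G := G) βt (PottsGaugeZd.linkBox (d := 3) n))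
              {U | PottsGaugeZd.IsFlat U p}).toReal + 2 * δ ≤
            ((PottsGaugeZd.closedMeasure (G := G) βt (PottsGaugeZd.linkBox (d := 3) n))
              {U | PottsGaugeZd.IsFlat U p}).toReal := by
  obtain ⟨q₀, hq⟩ := h
  refine ⟨q₀, fun G _ _ _ _ hc hG => ?_⟩
  obtain ⟨βt, k, k', -, -, -, ha, hb, -, -, -⟩ := hq G hc hG
  refine ⟨βt, fun p => ?_⟩
  obtain ⟨δ₁, hδ₁, h₁⟩ := ha p
  obtain ⟨δ₂, hδ₂, h₂⟩ := hb p
  refine ⟨min δ₁ δ₂, lt_min hδ₁ hδ₂, ?_⟩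
  filter_upwards [h₁, h₂] with n hn₁ hn₂
  have hm₁ : min δ₁ δ₂ ≤ δ₁ := min_le_left _ _
  have hm₂ : min δ₁ δ₂ ≤ δ₂ := min_le_right _ _
  linarith

/-- **Area law at the transition point (Thm 1.5 (a) at `β = β'_t > 0`), extracted from the
fact:** the free-b.c. Wilson parameter of the `L × T` loop is eventually `≤ e^{-kLT} + ε` at
`β'_t` itself, while (Thm 1.5 (c)) the closed-b.c. one is eventually `≥ e^{-k'(L+T)} - ε` there —
the printed "discontinuity of the Wilson string tension" in finite-volume form.
[cite: KoteckyLaanaitMessagerRuiz1990, Thm. 1.5 (a), (c)] -/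
theorem KLMR1990_thm14_thm15.areaLaw (h : KLMR1990_thm14_thm15) :
    ∃ q₀ : ℕ, ∀ (G : Type) [Group G] [Fintype G] [MeasurableSpace G] [MeasurableSingletonClass G],
      IsCyclic G → q₀ ≤ Fintype.card G → ∃ βt k k' : ℝ, 0 < k ∧ 0 < k' ∧
        (0 < βt → ∀ L T : ℕ, 1 ≤ L → 1 ≤ T → ∀ ε : ℝ, 0 < ε → ∀ᶠ n : ℕ in atTop,
          ∫ U, wilsonLoopObs (PottsGaugeZd.wilsonParamFn G) (rectWalk (0 : Fin 3 → ℤ) 0 1 L T) U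
              ∂(PottsGaugeZd.freeMeasure (G := G) βt (PottsGaugeZd.linkBox (d := 3) n)) ≤
            Real.exp (-k * L * T) + ε ∧
          Real.exp (-k' * (L + T)) - ε ≤
            ∫ U, wilsonLoopObs (PottsGaugeZd.wilsonParamFn G) (rectWalk (0 : Fin 3 → ℤ) 0 1 L T) U
              ∂(PottsGaugeZd.closedMeasure (G := G) βt (PottsGaugeZd.linkBox (d := 3) n))) := by
  obtain ⟨q₀, hq⟩ := h
  refine ⟨q₀, fun G _ _ _ _ hc hG => ?_⟩
  obtain ⟨βt, k, k', hk, hk', -, -, -, ha, -, hc'⟩ := hq G hc hG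
  refine ⟨βt, k, k', hk, hk', fun hβt L T hL hT ε hε => ?_⟩
  filter_upwards [ha βt hβt le_rfl L T hL hT ε hε, hc' βt le_rfl L T hL hT ε hε] with n h1 h2
  exact ⟨h1, h2⟩

end Literature.MathematicalPhysics.QuantumFieldTheory
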